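import Literature.NumberTheory.Rogawski1990.ArchCentralValueTransferRayScaling   -- ★ `ArchSmooth₂.smul`, `IsDeltaTransferRel`, `ArchTransferFactor`, `IsArchDeltaTransfer`
import Literature.NumberTheory.Rogawski1990.LocalTransferLinear                   -- ★ `IsDeltaTransferRel.smul_fun`, `stableOrbitalIntegralRel_smul_fun`
import Literature.NumberTheory.Rogawski1990.ArchCanonicalTransferFactor           -- ★ `archCanonicalTransferFactor` = `Δ‴_∞(μ)`
import Literature.NumberTheory.Weil1964.UnitaryArchSingularTopFormFamily          -- ★ `archSingularTopFormFamily` (the (κ-arch) functional of socket #21)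
import Literature.NumberTheory.Rogawski1990.GlobalTransferFactor                  -- ★ `cmRationalToArch`
import HarnessLib

/-!
# K2 · E4 helper — (κ-arch) TRANSPORT ALONG A RAY OF ARCHIMEDEAN TRANSFER FACTORS («socket #21 on the ray»)

Cell `pub/hodgecm-mathlib`, Track B «K2-LIT», seat `hodgecm-mathlib-K2E4-p21` (g0); crux H413 = `stmt-HodgeConjecture-24833` (supports-only, count-neutral).
THEOREMS ONLY (no definition, no instance, no notation, no named fact, no `sorry`).

Socket #21 `sig_K2E4WeakMatrixArchTransport` of `Cruxes/H413/Lines/K2_E4_SingularTransferKappaSignSigsWeakMatrixRigidity.lean` (U1 «WeakMatrixRigidity», NOT IN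
PRINT) asks: (κ-arch) with a non-zero constant for the explicit factor `Δ‴_∞(μ) = archCanonicalTransferFactor L H′ μ` ⟹ (κ-arch) with a non-zero constant for a WEAK
archimedean factor `Tinf` tied to `Δ‴_∞(μ)` only through the letters' matrices `hCTM` ∕ `hACS`.  In general that is the planners' «singular-pair rigidity of weak-matrix
data» (research-grade; see the seat's census `K2/K2E4-p21/g0/BLOCKED-socket21-census.K2E4-p21-g0.md`).  THIS FILE proves the transport in the one case that is pure
bookkeeping and that rung 0 meets when `Tinf` is pinned on the RAY of the explicit factor (★ `archCanonicalTransferFactor_Δ`: `Δ‴_∞ = c(H′)·Δ″_∞`; the #77 pay-down lines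
are framed on `T.Δ = c · Δ″_∞`, `c ≠ 0`): if `T.Δ(γ_H, γ′) = c · T′.Δ(γ_H, γ′)` at every `G`-regular `γ_H` with `c ≠ 0`, then `a^H` is a `T`-transfer of `a` iff
`c⁻¹ • a^H` is a `T′`-transfer of `a` ((4.3.1) is read only at `G`-regular `γ_H` and is linear in `a^H`), `C_c^∞(H_∞)` is closed under scalars, and therefore
(κ-arch)[T′, cinf₁] ⟹ (κ-arch)[T, cinf₁ · c⁻¹] for ANY functional of `a` and ANY evaluation point of `a^H` — in particular for the singular stable orbital integral
`Φ^st(γ₀ ⊗ 1, a)` against Weil's singular top-form family and the point `γ_H ⊗ 1` of the socket.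

* §1 (abstract (4.3.1), ★ `IsDeltaTransferRel`) `isDeltaTransferRel_inv_smul_of_delta_eq_const_mul`, `kappaTransport_of_delta_eq_const_mul`.
* §2 (the `arch` dress) **`archKappaTransport_of_delta_eq_const_mul`** (any functional ∕ point), **`weakMatrixArchTransport_of_ray`** (socket #21's
  functional and point verbatim: `(Hcan) → (Hweak)` under the ray hypothesis `Tinf.Δ =_{G-reg} c · (archCanonicalTransferFactor L H′ μ).Δ`).

HONEST LABEL: HC_CM is proved only modulo the 7 printed citations (2 remaining named inputs: hLiu418 = stmt-HodgeConjecture-24832, h413 = stmt-HodgeConjecture-24833)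
until rung 0 closes; this file proves no printed statement and does NOT pay socket #21 (it discharges it only on the ray).

## References
* [Rogawski1990] J. D. Rogawski, *Automorphic Representations of Unitary Groups in Three Variables*, Ann. of Math. Stud. 123 (1990): §4.3 (4.3.1) p. 43
  (the `Δ`-transfer identity at `G`-regular `γ_H`); §14.3 pp. 233–234 (its archimedean form); §14.6 p. 242 («`Δ′_v = c_v Δ″_v`», `c = ±1`); Prop. 8.2.1 (a) p. 118.
* [LanglandsShelstad1987] R. P. Langlands, D. Shelstad, On the definition of transfer factors, Math. Ann. 278 (1987), §1.3–1.4, §6.4.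
-/

set_option autoImplicit false
set_option linter.dupNamespace false

noncomputable section

open MeasureTheory Measure NumberField
open Literature.NumberTheory.Rogawski1990 Literature.NumberTheory.Automorphic Literature.NumberTheory.GaloisRepresentations
open scoped Matrix MatrixGroups ENNReal

namespace Summit.HodgeConjecture.HodgeConjecture.Cruxes.H413.K2E4WeakMatrixArchTransportOfRay

/-! ## §1 Abstract: (4.3.1) along a ray of transfer factors -/

section Abstract

variable {A B : Type*} [Group A] [Group B]
  [∀ a : A, MeasurableSpace (A ⧸ Subgroup.centralizer ({a} : Set A))]
  [∀ b : B, MeasurableSpace (B ⧸ Subgroup.centralizer ({b} : Set B))]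

/-- **(4.3.1) along a ray**: if `Δ_T(γ_H, γ) = c · Δ_{T′}(γ_H, γ)` at every `G`-regular `γ_H` (`c ≠ 0`) and `f → f^H` for `T`, then `f → c⁻¹ • f^H` for `T′`
(`Φ^st_H` is linear in `f^H`, ★ `stableOrbitalIntegralRel_smul_fun`; the class sum acquires the factor `c`, Mathlib `mul_finsum`).
[cite: Rogawski1990, §4.3 (4.3.1) p. 43; §14.6 p. 242] -/
theorem isDeltaTransferRel_inv_smul_of_delta_eq_const_mul {R : A → B → Prop} {stA : A → A → Prop} {regA : A → Prop}
    {T T' : TransferFactorData A B R} {mH : OrbitalMeasureFamily A} {mG : OrbitalMeasureFamily B} {fH : A → ℂ} {f : B → ℂ} {c : ℂ}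
    (hc : c ≠ 0) (hT : ∀ (a : A) (b : B), regA a → T.Δ a b = c * T'.Δ a b) (h : IsDeltaTransferRel R stA regA T mH mG fH f) :
    IsDeltaTransferRel R stA regA T' mH mG (c⁻¹ • fH) f := by
  intro a ha
  rw [stableOrbitalIntegralRel_smul_fun, h a ha]
  have e : ∑ᶠ x : ConjClasses B, T.Δ a (Quotient.out x) * classOrbitalIntegral mG f x =
      c * ∑ᶠ x : ConjClasses B, T'.Δ a (Quotient.out x) * classOrbitalIntegral mG f x := by
    rw [mul_finsum]
    exact finsum_congr fun x => by rw [hT a _ ha, mul_assoc]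
  rw [e, ← mul_assoc, inv_mul_cancel₀ hc, one_mul]

/-- **κ-TRANSPORT along a ray, abstract form**: with `Δ_T = c · Δ_{T′}` at the `G`-regular `γ_H` (`c ≠ 0`) and a test class `Smooth_H` closed under scalars,
«`F f = κ₁ · f^H(x₀)` for every `T′`-transfer pair» implies «`F f = (κ₁ c⁻¹) · f^H(x₀)` for every `T`-transfer pair», for ANY functional `F` of `f` and ANY
point `x₀` (the pair `(c⁻¹ • f^H, f)` is a `T′`-pair). [cite: Rogawski1990, §4.3 (4.3.1) p. 43; Prop. 8.2.1 (a) p. 118] -/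
theorem kappaTransport_of_delta_eq_const_mul {R : A → B → Prop} {stA : A → A → Prop} {regA : A → Prop}
    {T T' : TransferFactorData A B R} {mH : OrbitalMeasureFamily A} {mG : OrbitalMeasureFamily B} {c : ℂ}
    (hc : c ≠ 0) (hT : ∀ (a : A) (b : B), regA a → T.Δ a b = c * T'.Δ a b)
    (SmoothG : (B → ℂ) → Prop) (SmoothH : (A → ℂ) → Prop) (hH : ∀ (z : ℂ) (fH : A → ℂ), SmoothH fH → SmoothH (z • fH))
    (F : (B → ℂ) → ℂ) (x₀ : A) {κ₁ : ℂ} (hκ₁ : κ₁ ≠ 0)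
    (h : ∀ (fH : A → ℂ) (f : B → ℂ), SmoothG f → SmoothH fH → IsDeltaTransferRel R stA regA T' mH mG fH f → F f = κ₁ * fH x₀) :
    ∃ κ : ℂ, κ ≠ 0 ∧
      ∀ (fH : A → ℂ) (f : B → ℂ), SmoothG f → SmoothH fH → IsDeltaTransferRel R stA regA T mH mG fH f → F f = κ * fH x₀ := by
  refine ⟨κ₁ * c⁻¹, mul_ne_zero hκ₁ (inv_ne_zero hc), fun fH f hf hfH hrel => ?_⟩
  have key := h (c⁻¹ • fH) f hf (hH _ fH hfH) (isDeltaTransferRel_inv_smul_of_delta_eq_const_mul hc hT hrel)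
  rw [key, Pi.smul_apply, smul_eq_mul, mul_assoc]

end Abstract

/-! ## §2 The archimedean dress: `H_∞ = U(Φ₂)(L⁺ ⊗ ℝ) × U(Φ₁)(L⁺ ⊗ ℝ)`, `G′_∞ = U(H′)(L⁺ ⊗ ℝ)`, test classes `C_c^∞` by restriction -/

section Arch

variable (L : Type) [Field L] [NumberField L] [IsCMField L] (H' : Matrix (Fin 3) (Fin 3) L)

/-- **κ-TRANSPORT along a ray at `∞`**: for archimedean transfer factors `T, T′` with `T.Δ(γ_H, γ′) = c · T′.Δ(γ_H, γ′)` at every `G`-regular `γ_H ∈ H_∞`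
(`c ≠ 0`), «(κ-arch) with constant `cinf₁ ≠ 0` for `T′`» implies «(κ-arch) with constant `cinf₁ · c⁻¹ ≠ 0` for `T`», for ANY functional `F` of the
`G′_∞`-test function and ANY evaluation point `x₀ ∈ H_∞` (§14.3's identity is read only at `G`-regular `γ_H`, ★ `isArchDeltaTransfer_iff`; `C_c^∞(H_∞)` is closed
under scalars, ★ `ArchSmooth₂.smul`). [cite: Rogawski1990, §14.3 pp. 233–234; §14.6 p. 242; Prop. 8.2.1 (a) p. 118] -/
theorem archKappaTransport_of_delta_eq_const_mul
    {_ha : ∀ a : (UnitaryGroup.arch (↥(maximalRealSubfield L)) L (IsCMField.complexConj L) 2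
          (Matrix.of fun i j : Fin 2 => if i.val + j.val + 1 = 2 then (1 : L) else 0) ×
        UnitaryGroup.arch (↥(maximalRealSubfield L)) L (IsCMField.complexConj L) 1
          (Matrix.of fun i j : Fin 1 => if i.val + j.val + 1 = 1 then (1 : L) else 0)),
      MeasurableSpace ((UnitaryGroup.arch (↥(maximalRealSubfield L)) L (IsCMField.complexConj L) 2
          (Matrix.of fun i j : Fin 2 => if i.val + j.val + 1 = 2 then (1 : L) else 0) ×
        UnitaryGroup.arch (↥(maximalRealSubfield L)) L (IsCMField.complexConj L) 1
          (Matrix.of fun i j : Fin 1 => if i.val + j.val + 1 = 1 then (1 : L) else 0)) ⧸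
        Subgroup.centralizer ({a} : Set (UnitaryGroup.arch (↥(maximalRealSubfield L)) L (IsCMField.complexConj L) 2
          (Matrix.of fun i j : Fin 2 => if i.val + j.val + 1 = 2 then (1 : L) else 0) ×
        UnitaryGroup.arch (↥(maximalRealSubfield L)) L (IsCMField.complexConj L) 1
          (Matrix.of fun i j : Fin 1 => if i.val + j.val + 1 = 1 then (1 : L) else 0))))}
    {_hγ : ∀ γ : UnitaryGroup.arch (↥(maximalRealSubfield L)) L (IsCMField.complexConj L) 3 H',
      MeasurableSpace (UnitaryGroup.arch (↥(maximalRealSubfield L)) L (IsCMField.complexConj L) 3 H' ⧸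
        Subgroup.centralizer ({γ} : Set (UnitaryGroup.arch (↥(maximalRealSubfield L)) L (IsCMField.complexConj L) 3 H')))}
    {T T' : ArchTransferFactor L H'} {c : ℂ} (hc : c ≠ 0)
    (hT : ∀ (γH : UnitaryGroup.arch (↥(maximalRealSubfield L)) L (IsCMField.complexConj L) 2
            (Matrix.of fun i j : Fin 2 => if i.val + j.val + 1 = 2 then (1 : L) else 0) ×
          UnitaryGroup.arch (↥(maximalRealSubfield L)) L (IsCMField.complexConj L) 1
            (Matrix.of fun i j : Fin 1 => if i.val + j.val + 1 = 1 then (1 : L) else 0))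
        (γ' : UnitaryGroup.arch (↥(maximalRealSubfield L)) L (IsCMField.complexConj L) 3 H'),
        IsArchGRegular L γH → T.Δ γH γ' = c * T'.Δ γH γ')
    (mHi : OrbitalMeasureFamily (UnitaryGroup.arch (↥(maximalRealSubfield L)) L (IsCMField.complexConj L) 2
          (Matrix.of fun i j : Fin 2 => if i.val + j.val + 1 = 2 then (1 : L) else 0) ×
        UnitaryGroup.arch (↥(maximalRealSubfield L)) L (IsCMField.complexConj L) 1
          (Matrix.of fun i j : Fin 1 => if i.val + j.val + 1 = 1 then (1 : L) else 0)))
    (m' : OrbitalMeasureFamily (UnitaryGroup.arch (↥(maximalRealSubfield L)) L (IsCMField.complexConj L) 3 H'))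
    (F : (UnitaryGroup.arch (↥(maximalRealSubfield L)) L (IsCMField.complexConj L) 3 H' → ℂ) → ℂ)
    (x₀ : UnitaryGroup.arch (↥(maximalRealSubfield L)) L (IsCMField.complexConj L) 2
          (Matrix.of fun i j : Fin 2 => if i.val + j.val + 1 = 2 then (1 : L) else 0) ×
        UnitaryGroup.arch (↥(maximalRealSubfield L)) L (IsCMField.complexConj L) 1
          (Matrix.of fun i j : Fin 1 => if i.val + j.val + 1 = 1 then (1 : L) else 0))
    {cinf₁ : ℂ} (h₁ : cinf₁ ≠ 0)
    (h : ∀ (aH : UnitaryGroup.arch (↥(maximalRealSubfield L)) L (IsCMField.complexConj L) 2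
            (Matrix.of fun i j : Fin 2 => if i.val + j.val + 1 = 2 then (1 : L) else 0) ×
          UnitaryGroup.arch (↥(maximalRealSubfield L)) L (IsCMField.complexConj L) 1
            (Matrix.of fun i j : Fin 1 => if i.val + j.val + 1 = 1 then (1 : L) else 0) → ℂ)
        (a : UnitaryGroup.arch (↥(maximalRealSubfield L)) L (IsCMField.complexConj L) 3 H' → ℂ),
        ArchSmooth L 3 H' a → ArchSmooth₂ L aH → IsArchDeltaTransfer L H' T' mHi m' aH a → F a = cinf₁ * aH x₀) :
    ∃ cinf : ℂ, cinf ≠ 0 ∧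
      ∀ (aH : UnitaryGroup.arch (↥(maximalRealSubfield L)) L (IsCMField.complexConj L) 2
            (Matrix.of fun i j : Fin 2 => if i.val + j.val + 1 = 2 then (1 : L) else 0) ×
          UnitaryGroup.arch (↥(maximalRealSubfield L)) L (IsCMField.complexConj L) 1
            (Matrix.of fun i j : Fin 1 => if i.val + j.val + 1 = 1 then (1 : L) else 0) → ℂ)
        (a : UnitaryGroup.arch (↥(maximalRealSubfield L)) L (IsCMField.complexConj L) 3 H' → ℂ),
        ArchSmooth L 3 H' a → ArchSmooth₂ L aH → IsArchDeltaTransfer L H' T mHi m' aH a → F a = cinf * aH x₀ :=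
  kappaTransport_of_delta_eq_const_mul hc (fun a b ha => hT a b ha) (ArchSmooth L 3 H') (ArchSmooth₂ L)
    (fun z _ hfH => ArchSmooth₂.smul L hfH z) F x₀ h₁ h

/-- **SOCKET #21 ON THE RAY** — `sig_K2E4WeakMatrixArchTransport`'s implication `(Hcan) → (Hweak)` with its functional (the singular stable orbital integral
`Φ^st(γ₀ ⊗ 1, a)` against Weil's singular top-form family ★ `archSingularTopFormFamily L H′ νGi`) and its evaluation point `γ_H ⊗ 1` VERBATIM, under the extra RAY
hypothesis `Tinf.Δ(γ_H, γ′) = c · Δ‴_∞(μ).Δ(γ_H, γ′)` at the `G`-regular `γ_H` (`c ≠ 0`; `Δ‴_∞(μ)` = ★ `archCanonicalTransferFactor L H′ μ`).  The weak-matrix case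
(no ray hypothesis) is the planners' «singular-pair rigidity» and is NOT claimed here. [cite: Rogawski1990, Prop. 8.2.1 (a) p. 118; §14.6 p. 242; §14.3 pp. 233–234] -/
theorem weakMatrixArchTransport_of_ray
    [MeasurableSpace (UnitaryGroup.arch (↥(maximalRealSubfield L)) L (IsCMField.complexConj L) 3 H')]
    [BorelSpace (UnitaryGroup.arch (↥(maximalRealSubfield L)) L (IsCMField.complexConj L) 3 H')]
    [∀ γ : UnitaryGroup.arch (↥(maximalRealSubfield L)) L (IsCMField.complexConj L) 3 H',
      MeasurableSpace (UnitaryGroup.arch (↥(maximalRealSubfield L)) L (IsCMField.complexConj L) 3 H' ⧸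
        Subgroup.centralizer ({γ} : Set (UnitaryGroup.arch (↥(maximalRealSubfield L)) L (IsCMField.complexConj L) 3 H')))]
    [∀ γ : UnitaryGroup.arch (↥(maximalRealSubfield L)) L (IsCMField.complexConj L) 3 H',
      BorelSpace (UnitaryGroup.arch (↥(maximalRealSubfield L)) L (IsCMField.complexConj L) 3 H' ⧸
        Subgroup.centralizer ({γ} : Set (UnitaryGroup.arch (↥(maximalRealSubfield L)) L (IsCMField.complexConj L) 3 H')))]
    [∀ a : (UnitaryGroup.arch (↥(maximalRealSubfield L)) L (IsCMField.complexConj L) 2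
          (Matrix.of fun i j : Fin 2 => if i.val + j.val + 1 = 2 then (1 : L) else 0) ×
        UnitaryGroup.arch (↥(maximalRealSubfield L)) L (IsCMField.complexConj L) 1
          (Matrix.of fun i j : Fin 1 => if i.val + j.val + 1 = 1 then (1 : L) else 0)),
      MeasurableSpace ((UnitaryGroup.arch (↥(maximalRealSubfield L)) L (IsCMField.complexConj L) 2
          (Matrix.of fun i j : Fin 2 => if i.val + j.val + 1 = 2 then (1 : L) else 0) ×
        UnitaryGroup.arch (↥(maximalRealSubfield L)) L (IsCMField.complexConj L) 1
          (Matrix.of fun i j : Fin 1 => if i.val + j.val + 1 = 1 then (1 : L) else 0)) ⧸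
        Subgroup.centralizer ({a} : Set (UnitaryGroup.arch (↥(maximalRealSubfield L)) L (IsCMField.complexConj L) 2
          (Matrix.of fun i j : Fin 2 => if i.val + j.val + 1 = 2 then (1 : L) else 0) ×
        UnitaryGroup.arch (↥(maximalRealSubfield L)) L (IsCMField.complexConj L) 1
          (Matrix.of fun i j : Fin 1 => if i.val + j.val + 1 = 1 then (1 : L) else 0))))]
    (Tinf : ArchTransferFactor L H') (νGi : Measure (UnitaryGroup.arch (↥(maximalRealSubfield L)) L (IsCMField.complexConj L) 3 H'))
    [IsFiniteMeasureOnCompacts νGi] [νGi.IsMulRightInvariant]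
    (m' : OrbitalMeasureFamily (UnitaryGroup.arch (↥(maximalRealSubfield L)) L (IsCMField.complexConj L) 3 H'))
    (mHi : OrbitalMeasureFamily (UnitaryGroup.arch (↥(maximalRealSubfield L)) L (IsCMField.complexConj L) 2
          (Matrix.of fun i j : Fin 2 => if i.val + j.val + 1 = 2 then (1 : L) else 0) ×
        UnitaryGroup.arch (↥(maximalRealSubfield L)) L (IsCMField.complexConj L) 1
          (Matrix.of fun i j : Fin 1 => if i.val + j.val + 1 = 1 then (1 : L) else 0)))
    (μ : HeckeCharacter L) {c : ℂ} (hc : c ≠ 0)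
    (hray : ∀ (γH : UnitaryGroup.arch (↥(maximalRealSubfield L)) L (IsCMField.complexConj L) 2
            (Matrix.of fun i j : Fin 2 => if i.val + j.val + 1 = 2 then (1 : L) else 0) ×
          UnitaryGroup.arch (↥(maximalRealSubfield L)) L (IsCMField.complexConj L) 1
            (Matrix.of fun i j : Fin 1 => if i.val + j.val + 1 = 1 then (1 : L) else 0))
        (γ' : UnitaryGroup.arch (↥(maximalRealSubfield L)) L (IsCMField.complexConj L) 3 H'),
        IsArchGRegular L γH → Tinf.Δ γH γ' = c * (archCanonicalTransferFactor L H' μ).Δ γH γ')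
    (γ₀ : (UnitaryGroup.cmDatum L 3 H').Rational)
    (γH : (UnitaryGroup.cmDatum L 2 (Matrix.of fun i j : Fin 2 => if i.val + j.val + 1 = 2 then (1 : L) else 0)).Rational ×
      (UnitaryGroup.cmDatum L 1 (Matrix.of fun i j : Fin 1 => if i.val + j.val + 1 = 1 then (1 : L) else 0)).Rational) :
    (∃ cinf₁ : ℂ, cinf₁ ≠ 0 ∧
      (∀ (aH : UnitaryGroup.arch (↥(maximalRealSubfield L)) L (IsCMField.complexConj L) 2 (Matrix.of fun i j : Fin 2 => if i.val + j.val + 1 = 2 then (1 : L) else 0) ×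
              UnitaryGroup.arch (↥(maximalRealSubfield L)) L (IsCMField.complexConj L) 1 (Matrix.of fun i j : Fin 1 => if i.val + j.val + 1 = 1 then (1 : L) else 0) → ℂ)
            (a : UnitaryGroup.arch (↥(maximalRealSubfield L)) L (IsCMField.complexConj L) 3 H' → ℂ),
          ArchSmooth L 3 H' a → ArchSmooth₂ L aH → IsArchDeltaTransfer L H' (archCanonicalTransferFactor L H' μ) mHi m' aH a →
          archStableOrbitalIntegral L 3 H' (Literature.NumberTheory.Weil1964.UnitaryArchTopForm.archSingularTopFormFamily L H' νGi) a (cmRationalToArch L 3 H' γ₀) =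
            cinf₁ * aH (cmRationalToArch L 2 (Matrix.of fun i j : Fin 2 => if i.val + j.val + 1 = 2 then (1 : L) else 0) γH.1, cmRationalToArch L 1 (Matrix.of fun i j : Fin 1 => if i.val + j.val + 1 = 1 then (1 : L) else 0) γH.2))) →
    ∃ cinf : ℂ, cinf ≠ 0 ∧
      (∀ (aH : UnitaryGroup.arch (↥(maximalRealSubfield L)) L (IsCMField.complexConj L) 2 (Matrix.of fun i j : Fin 2 => if i.val + j.val + 1 = 2 then (1 : L) else 0) ×
              UnitaryGroup.arch (↥(maximalRealSubfield L)) L (IsCMField.complexConj L) 1 (Matrix.of fun i j : Fin 1 => if i.val + j.val + 1 = 1 then (1 : L) else 0) → ℂ)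
            (a : UnitaryGroup.arch (↥(maximalRealSubfield L)) L (IsCMField.complexConj L) 3 H' → ℂ),
          ArchSmooth L 3 H' a → ArchSmooth₂ L aH → IsArchDeltaTransfer L H' Tinf mHi m' aH a →
          archStableOrbitalIntegral L 3 H' (Literature.NumberTheory.Weil1964.UnitaryArchTopForm.archSingularTopFormFamily L H' νGi) a (cmRationalToArch L 3 H' γ₀) =
            cinf * aH (cmRationalToArch L 2 (Matrix.of fun i j : Fin 2 => if i.val + j.val + 1 = 2 then (1 : L) else 0) γH.1, cmRationalToArch L 1 (Matrix.of fun i j : Fin 1 => if i.val + j.val + 1 = 1 then (1 : L) else 0) γH.2)) := by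
  rintro ⟨cinf₁, h₁, h⟩
  exact archKappaTransport_of_delta_eq_const_mul L H' hc hray mHi m' _ _ h₁ h

end Arch

end Summit.HodgeConjecture.HodgeConjecture.Cruxes.H413.K2E4WeakMatrixArchTransportOfRay

end
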